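import Summits.ValiantsHypothesis.ValiantsHypothesis.Theorems.FreeSubtorusOrbitDimensionBoundStubJordanHolderConfluence

/-!
# `OrbitDimensionBound` (stmt-ValiantsHypothesis-16133), rung line `filtered_covering` — stub `stub_jordanHolder`,
# part 3: the registered stub (Jordan–Hölder transport along a common degeneration)

Last file for stub 2 `stub_jordanHolder` of `Cruxes/OrbitDimensionBound/Lines/filtered_covering.lean` (route `FreeSubtorus`,
rung `Depth.FilteredShadow`; stub 1 `stub_polystableModel` is `…StubPolystableModel.lean`).  Assembling parts 1–2
(`…StubJordanHolderAdaptedBasis`, `…StubJordanHolderConfluence`):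

* §1 gauge bookkeeping in the workfile's unfolded format — depth `0` = constant gauge (`gauge_of_degZero`,
  `degZero_of_gauge`), `gauge_symm`, `gauge_trans`, a degeneration of a gauge form is a degeneration
  (`deg_of_gauge_deg`), and **degeneration-closedness is a gauge invariant** (`closed_of_gauge`);
* §2 **`stub_jordanHolder`** — the registered stub `Depth.Line.Stmt.stub_jordanHolder` with the workfile definitions
  `IsDegeneration` / `weightTruncate` / `IsDegenerationClosed` UNFOLDED (Theorems cannot import Cruxes; `weightTruncate a b X`
  is `Matrix.of fun i j => if a i = b j then X i j else 0`): if `A` and `A'` have a common one-parameter degeneration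
  `B`, any degeneration-closed degeneration `P` of `A` and any degeneration-closed degeneration `P'` of `A'` are
  constant-gauge equivalent.  Proof (local confluence three times): a common degeneration `E₁` of `B` and `P` is a gauge
  form of `P` (closed), likewise `E₂` of `B` and `P'` is a gauge form of `P'`; `E₁, E₂` are closed (gauge invariance),
  so a common degeneration `E₃` of `E₁, E₂` (confluence on `B`) is a gauge form of both: `P ∼ E₁ ∼ E₃ ∼ E₂ ∼ P'`.
  The hypothesis `det A ≠ 0` is not used (cf. the Negative-lane audit `…/Negative/FilteredCoveringJordanHolderAudit.lean`,
  which shows the two closedness hypotheses ARE load-bearing).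

Helper mode (`--supports stmt-ValiantsHypothesis-16133 --as helper`); the one-line wiring
`theorem stub_jordanHolder : Stmt.stub_jordanHolder := …JordanHolder.stub_jordanHolder` in the workfile is for a 16133
crux-write hand (δ-probe against verbatim copies of the workfile definitions: rc 0).  Honest framing: [folklore] linear
algebra in the spirit of [cite: King1994, Thm. 4.1] (S-equivalence via associated gradeds); closing this stub makes the
RUNG workfile `filtered_covering` sorry-free (`FilteredShadow_proof`); the rung is NOT the item's statement — the crux
`OrbitDimensionBound` (stmt-16133), the route `FreeSubtorus` and VP ≠ VNP remain OPEN and are not moved by this file.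

## References (orientation only)
* A. D. King, Moduli of representations of finite-dimensional algebras, Quart. J. Math. 45 (1994), §2, Thm. 4.1.
-/

set_option linter.dupNamespace false

namespace Summit.ValiantsHypothesis.ValiantsHypothesis.Theorems.FreeSubtorusOrbitDimensionBound.JordanHolder

open Matrix MvPolynomial

/-! ### §1 Gauge bookkeeping (depth `0` = constant gauge) -/

section Glue

variable {K : Type*} [Field K] {σ : Type*} {m : ℕ}

/-- A depth-`0` degeneration is a constant gauge form (both weight vectors vanish). [folklore] -/
theorem gauge_of_degZero (X Y : Matrix (Fin m) (Fin m) (MvPolynomial σ K))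
    (hd : ∃ (g h : GL (Fin m) K) (a b : Fin m → ℕ),
      (∀ i, (a i : ℕ∞) ≤ 0) ∧ (∀ j, (b j : ℕ∞) ≤ 0) ∧ ∑ i, a i = ∑ j, b j ∧
      (∀ i j, a i < b j →
        ((g : Matrix (Fin m) (Fin m) K).map C * X * (h : Matrix (Fin m) (Fin m) K).map C :
          Matrix (Fin m) (Fin m) (MvPolynomial σ K)) i j = 0) ∧
      Y = Matrix.of fun i j => if a i = b j then
        ((g : Matrix (Fin m) (Fin m) K).map C * X * (h : Matrix (Fin m) (Fin m) K).map C :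
          Matrix (Fin m) (Fin m) (MvPolynomial σ K)) i j else 0) :
    ∃ g h : GL (Fin m) K,
      Y = (g : Matrix (Fin m) (Fin m) K).map C * X * (h : Matrix (Fin m) (Fin m) K).map C := by
  obtain ⟨g, h, a, b, ha, hb, -, -, hY⟩ := hd
  have ha0 : ∀ i, a i = 0 := fun i => by exact_mod_cast nonpos_iff_eq_zero.mp (ha i)
  have hb0 : ∀ j, b j = 0 := fun j => by exact_mod_cast nonpos_iff_eq_zero.mp (hb j)
  refine ⟨g, h, ?_⟩
  rw [hY]
  ext i j
  simp [ha0, hb0]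

/-- A constant gauge form is a depth-`0` degeneration (weights `0`). [folklore] -/
theorem degZero_of_gauge (X Y : Matrix (Fin m) (Fin m) (MvPolynomial σ K)) (g₀ h₀ : GL (Fin m) K)
    (e : Y = (g₀ : Matrix (Fin m) (Fin m) K).map C * X * (h₀ : Matrix (Fin m) (Fin m) K).map C) :
    ∃ (g h : GL (Fin m) K) (a b : Fin m → ℕ),
      (∀ i, (a i : ℕ∞) ≤ 0) ∧ (∀ j, (b j : ℕ∞) ≤ 0) ∧ ∑ i, a i = ∑ j, b j ∧
      (∀ i j, a i < b j →
        ((g : Matrix (Fin m) (Fin m) K).map C * X * (h : Matrix (Fin m) (Fin m) K).map C :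
          Matrix (Fin m) (Fin m) (MvPolynomial σ K)) i j = 0) ∧
      Y = Matrix.of fun i j => if a i = b j then
        ((g : Matrix (Fin m) (Fin m) K).map C * X * (h : Matrix (Fin m) (Fin m) K).map C :
          Matrix (Fin m) (Fin m) (MvPolynomial σ K)) i j else 0 := by
  refine ⟨g₀, h₀, fun _ => 0, fun _ => 0, fun _ => by simp, fun _ => by simp, rfl,
    fun i j hij => (lt_irrefl _ hij).elim, ?_⟩
  rw [e]
  ext i j
  simp

/-- Inverting a constant gauge. [folklore] -/
theorem gauge_symm (X Y : Matrix (Fin m) (Fin m) (MvPolynomial σ K)) (g h : GL (Fin m) K)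
    (e : Y = (g : Matrix (Fin m) (Fin m) K).map C * X * (h : Matrix (Fin m) (Fin m) K).map C) :
    X = ((g⁻¹ : GL (Fin m) K) : Matrix (Fin m) (Fin m) K).map C * Y *
      ((h⁻¹ : GL (Fin m) K) : Matrix (Fin m) (Fin m) K).map C := by
  rw [e, ← gauge_assoc, ← Units.val_mul, ← Units.val_mul, inv_mul_cancel, mul_inv_cancel, Units.val_one,
    Matrix.map_one C C_0 C_1, Matrix.one_mul, Matrix.mul_one]

/-- Composing constant gauges. [folklore] -/
theorem gauge_trans (X Y Z : Matrix (Fin m) (Fin m) (MvPolynomial σ K)) (g h g' h' : GL (Fin m) K)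
    (e : Y = (g : Matrix (Fin m) (Fin m) K).map C * X * (h : Matrix (Fin m) (Fin m) K).map C)
    (e' : Z = (g' : Matrix (Fin m) (Fin m) K).map C * Y * (h' : Matrix (Fin m) (Fin m) K).map C) :
    Z = ((g' * g : GL (Fin m) K) : Matrix (Fin m) (Fin m) K).map C * X *
      ((h * h' : GL (Fin m) K) : Matrix (Fin m) (Fin m) K).map C := by
  rw [e', e, Units.val_mul, Units.val_mul, gauge_assoc]

/-- A degeneration (any depth `q`) of a constant gauge form of `X` is a degeneration of `X` (same weights, composed
gauge). [folklore] -/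
theorem deg_of_gauge_deg (q : ℕ∞) (X Y B : Matrix (Fin m) (Fin m) (MvPolynomial σ K)) (g₀ h₀ : GL (Fin m) K)
    (e : Y = (g₀ : Matrix (Fin m) (Fin m) K).map C * X * (h₀ : Matrix (Fin m) (Fin m) K).map C)
    (hd : ∃ (g h : GL (Fin m) K) (a b : Fin m → ℕ),
      (∀ i, (a i : ℕ∞) ≤ q) ∧ (∀ j, (b j : ℕ∞) ≤ q) ∧ ∑ i, a i = ∑ j, b j ∧
      (∀ i j, a i < b j →
        ((g : Matrix (Fin m) (Fin m) K).map C * Y * (h : Matrix (Fin m) (Fin m) K).map C :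
          Matrix (Fin m) (Fin m) (MvPolynomial σ K)) i j = 0) ∧
      B = Matrix.of fun i j => if a i = b j then
        ((g : Matrix (Fin m) (Fin m) K).map C * Y * (h : Matrix (Fin m) (Fin m) K).map C :
          Matrix (Fin m) (Fin m) (MvPolynomial σ K)) i j else 0) :
    ∃ (g h : GL (Fin m) K) (a b : Fin m → ℕ),
      (∀ i, (a i : ℕ∞) ≤ q) ∧ (∀ j, (b j : ℕ∞) ≤ q) ∧ ∑ i, a i = ∑ j, b j ∧
      (∀ i j, a i < b j →
        ((g : Matrix (Fin m) (Fin m) K).map C * X * (h : Matrix (Fin m) (Fin m) K).map C :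
          Matrix (Fin m) (Fin m) (MvPolynomial σ K)) i j = 0) ∧
      B = Matrix.of fun i j => if a i = b j then
        ((g : Matrix (Fin m) (Fin m) K).map C * X * (h : Matrix (Fin m) (Fin m) K).map C :
          Matrix (Fin m) (Fin m) (MvPolynomial σ K)) i j else 0 := by
  obtain ⟨g, h, a, b, ha, hb, hs, hz, hB⟩ := hd
  have key : (g : Matrix (Fin m) (Fin m) K).map C * Y * (h : Matrix (Fin m) (Fin m) K).map C =
      ((g * g₀ : GL (Fin m) K) : Matrix (Fin m) (Fin m) K).map C * X *
        ((h₀ * h : GL (Fin m) K) : Matrix (Fin m) (Fin m) K).map C :=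
    gauge_trans X Y _ g₀ h₀ g h e rfl
  refine ⟨g * g₀, h₀ * h, a, b, ha, hb, hs, fun i j hij => ?_, ?_⟩
  · rw [← key]; exact hz i j hij
  · rw [← key]; exact hB

/-- **Degeneration-closedness is a gauge invariant.** [folklore] -/
theorem closed_of_gauge (X Y : Matrix (Fin m) (Fin m) (MvPolynomial σ K)) (g₀ h₀ : GL (Fin m) K)
    (e : Y = (g₀ : Matrix (Fin m) (Fin m) K).map C * X * (h₀ : Matrix (Fin m) (Fin m) K).map C)
    (hX : ∀ B : Matrix (Fin m) (Fin m) (MvPolynomial σ K),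
      (∃ (g h : GL (Fin m) K) (a b : Fin m → ℕ),
        (∀ i, (a i : ℕ∞) ≤ ⊤) ∧ (∀ j, (b j : ℕ∞) ≤ ⊤) ∧ ∑ i, a i = ∑ j, b j ∧
        (∀ i j, a i < b j →
          ((g : Matrix (Fin m) (Fin m) K).map C * X * (h : Matrix (Fin m) (Fin m) K).map C :
            Matrix (Fin m) (Fin m) (MvPolynomial σ K)) i j = 0) ∧
        B = Matrix.of fun i j => if a i = b j then
          ((g : Matrix (Fin m) (Fin m) K).map C * X * (h : Matrix (Fin m) (Fin m) K).map C :
            Matrix (Fin m) (Fin m) (MvPolynomial σ K)) i j else 0) →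
      (∃ (g h : GL (Fin m) K) (a b : Fin m → ℕ),
        (∀ i, (a i : ℕ∞) ≤ 0) ∧ (∀ j, (b j : ℕ∞) ≤ 0) ∧ ∑ i, a i = ∑ j, b j ∧
        (∀ i j, a i < b j →
          ((g : Matrix (Fin m) (Fin m) K).map C * X * (h : Matrix (Fin m) (Fin m) K).map C :
            Matrix (Fin m) (Fin m) (MvPolynomial σ K)) i j = 0) ∧
        B = Matrix.of fun i j => if a i = b j then
          ((g : Matrix (Fin m) (Fin m) K).map C * X * (h : Matrix (Fin m) (Fin m) K).map C :
            Matrix (Fin m) (Fin m) (MvPolynomial σ K)) i j else 0)) :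
    ∀ B : Matrix (Fin m) (Fin m) (MvPolynomial σ K),
      (∃ (g h : GL (Fin m) K) (a b : Fin m → ℕ),
        (∀ i, (a i : ℕ∞) ≤ ⊤) ∧ (∀ j, (b j : ℕ∞) ≤ ⊤) ∧ ∑ i, a i = ∑ j, b j ∧
        (∀ i j, a i < b j →
          ((g : Matrix (Fin m) (Fin m) K).map C * Y * (h : Matrix (Fin m) (Fin m) K).map C :
            Matrix (Fin m) (Fin m) (MvPolynomial σ K)) i j = 0) ∧
        B = Matrix.of fun i j => if a i = b j then
          ((g : Matrix (Fin m) (Fin m) K).map C * Y * (h : Matrix (Fin m) (Fin m) K).map C :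
            Matrix (Fin m) (Fin m) (MvPolynomial σ K)) i j else 0) →
      (∃ (g h : GL (Fin m) K) (a b : Fin m → ℕ),
        (∀ i, (a i : ℕ∞) ≤ 0) ∧ (∀ j, (b j : ℕ∞) ≤ 0) ∧ ∑ i, a i = ∑ j, b j ∧
        (∀ i j, a i < b j →
          ((g : Matrix (Fin m) (Fin m) K).map C * Y * (h : Matrix (Fin m) (Fin m) K).map C :
            Matrix (Fin m) (Fin m) (MvPolynomial σ K)) i j = 0) ∧
        B = Matrix.of fun i j => if a i = b j then
          ((g : Matrix (Fin m) (Fin m) K).map C * Y * (h : Matrix (Fin m) (Fin m) K).map C :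
            Matrix (Fin m) (Fin m) (MvPolynomial σ K)) i j else 0) := by
  intro B hB
  obtain ⟨g, h, hBg⟩ := gauge_of_degZero X B (hX B (deg_of_gauge_deg ⊤ X Y B g₀ h₀ e hB))
  -- `B = g X h`, `X = g₀⁻¹ Y h₀⁻¹`
  exact degZero_of_gauge Y B (g * g₀⁻¹) (h₀⁻¹ * h) (gauge_trans Y X B g₀⁻¹ h₀⁻¹ g h (gauge_symm X Y g₀ h₀ e) hBg)

end Glue

/-! ### §2 The registered stub -/

/-- **`stub_jordanHolder` (Jordan–Hölder transport of the polystable model along a common degeneration)** — the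
registered stub `Depth.Line.Stmt.stub_jordanHolder` of `Cruxes/OrbitDimensionBound/Lines/filtered_covering.lean` with
the workfile definitions `IsDegeneration` / `weightTruncate` / `IsDegenerationClosed` UNFOLDED: if `A` (`det A ≠ 0`,
unused) and `A'` have a common one-parameter degeneration `B`, then any degeneration-closed degeneration `P` of `A`
and any degeneration-closed degeneration `P'` of `A'` are constant-gauge equivalent.  Proof: local confluence
(`exists_common_degeneration`) three times and closedness — `P ∼ E₁` with `E₁` a degeneration of `B`, `P' ∼ E₂`
likewise, `E₁, E₂` closed (gauge invariance), a common degeneration `E₃` of `E₁, E₂` is a gauge form of both.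
[cite: King1994, Thm. 4.1] -/
theorem stub_jordanHolder :
    ∀ (n m : ℕ) (A A' B P P' : Matrix (Fin m) (Fin m) (MvPolynomial (Fin n × Fin n) ℂ)),
      A.det ≠ 0 →
      (∃ (g h : GL (Fin m) ℂ) (a b : Fin m → ℕ),
        (∀ i, (a i : ℕ∞) ≤ ⊤) ∧ (∀ j, (b j : ℕ∞) ≤ ⊤) ∧ ∑ i, a i = ∑ j, b j ∧
        (∀ i j, a i < b j →
          ((g : Matrix (Fin m) (Fin m) ℂ).map C * A * (h : Matrix (Fin m) (Fin m) ℂ).map C :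
            Matrix (Fin m) (Fin m) (MvPolynomial (Fin n × Fin n) ℂ)) i j = 0) ∧
        B = Matrix.of fun i j => if a i = b j then
          ((g : Matrix (Fin m) (Fin m) ℂ).map C * A * (h : Matrix (Fin m) (Fin m) ℂ).map C :
            Matrix (Fin m) (Fin m) (MvPolynomial (Fin n × Fin n) ℂ)) i j else 0) →
      (∃ (g h : GL (Fin m) ℂ) (a b : Fin m → ℕ),
        (∀ i, (a i : ℕ∞) ≤ ⊤) ∧ (∀ j, (b j : ℕ∞) ≤ ⊤) ∧ ∑ i, a i = ∑ j, b j ∧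
        (∀ i j, a i < b j →
          ((g : Matrix (Fin m) (Fin m) ℂ).map C * A' * (h : Matrix (Fin m) (Fin m) ℂ).map C :
            Matrix (Fin m) (Fin m) (MvPolynomial (Fin n × Fin n) ℂ)) i j = 0) ∧
        B = Matrix.of fun i j => if a i = b j then
          ((g : Matrix (Fin m) (Fin m) ℂ).map C * A' * (h : Matrix (Fin m) (Fin m) ℂ).map C :
            Matrix (Fin m) (Fin m) (MvPolynomial (Fin n × Fin n) ℂ)) i j else 0) →
      (∃ (g h : GL (Fin m) ℂ) (a b : Fin m → ℕ),
        (∀ i, (a i : ℕ∞) ≤ ⊤) ∧ (∀ j, (b j : ℕ∞) ≤ ⊤) ∧ ∑ i, a i = ∑ j, b j ∧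
        (∀ i j, a i < b j →
          ((g : Matrix (Fin m) (Fin m) ℂ).map C * A * (h : Matrix (Fin m) (Fin m) ℂ).map C :
            Matrix (Fin m) (Fin m) (MvPolynomial (Fin n × Fin n) ℂ)) i j = 0) ∧
        P = Matrix.of fun i j => if a i = b j then
          ((g : Matrix (Fin m) (Fin m) ℂ).map C * A * (h : Matrix (Fin m) (Fin m) ℂ).map C :
            Matrix (Fin m) (Fin m) (MvPolynomial (Fin n × Fin n) ℂ)) i j else 0) →
      (∀ B₁ : Matrix (Fin m) (Fin m) (MvPolynomial (Fin n × Fin n) ℂ),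
        (∃ (g h : GL (Fin m) ℂ) (a b : Fin m → ℕ),
          (∀ i, (a i : ℕ∞) ≤ ⊤) ∧ (∀ j, (b j : ℕ∞) ≤ ⊤) ∧ ∑ i, a i = ∑ j, b j ∧
          (∀ i j, a i < b j →
            ((g : Matrix (Fin m) (Fin m) ℂ).map C * P * (h : Matrix (Fin m) (Fin m) ℂ).map C :
              Matrix (Fin m) (Fin m) (MvPolynomial (Fin n × Fin n) ℂ)) i j = 0) ∧
          B₁ = Matrix.of fun i j => if a i = b j then
            ((g : Matrix (Fin m) (Fin m) ℂ).map C * P * (h : Matrix (Fin m) (Fin m) ℂ).map C :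
              Matrix (Fin m) (Fin m) (MvPolynomial (Fin n × Fin n) ℂ)) i j else 0) →
        (∃ (g h : GL (Fin m) ℂ) (a b : Fin m → ℕ),
          (∀ i, (a i : ℕ∞) ≤ 0) ∧ (∀ j, (b j : ℕ∞) ≤ 0) ∧ ∑ i, a i = ∑ j, b j ∧
          (∀ i j, a i < b j →
            ((g : Matrix (Fin m) (Fin m) ℂ).map C * P * (h : Matrix (Fin m) (Fin m) ℂ).map C :
              Matrix (Fin m) (Fin m) (MvPolynomial (Fin n × Fin n) ℂ)) i j = 0) ∧
          B₁ = Matrix.of fun i j => if a i = b j then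
            ((g : Matrix (Fin m) (Fin m) ℂ).map C * P * (h : Matrix (Fin m) (Fin m) ℂ).map C :
              Matrix (Fin m) (Fin m) (MvPolynomial (Fin n × Fin n) ℂ)) i j else 0)) →
      (∃ (g h : GL (Fin m) ℂ) (a b : Fin m → ℕ),
        (∀ i, (a i : ℕ∞) ≤ ⊤) ∧ (∀ j, (b j : ℕ∞) ≤ ⊤) ∧ ∑ i, a i = ∑ j, b j ∧
        (∀ i j, a i < b j →
          ((g : Matrix (Fin m) (Fin m) ℂ).map C * A' * (h : Matrix (Fin m) (Fin m) ℂ).map C :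
            Matrix (Fin m) (Fin m) (MvPolynomial (Fin n × Fin n) ℂ)) i j = 0) ∧
        P' = Matrix.of fun i j => if a i = b j then
          ((g : Matrix (Fin m) (Fin m) ℂ).map C * A' * (h : Matrix (Fin m) (Fin m) ℂ).map C :
            Matrix (Fin m) (Fin m) (MvPolynomial (Fin n × Fin n) ℂ)) i j else 0) →
      (∀ B₁ : Matrix (Fin m) (Fin m) (MvPolynomial (Fin n × Fin n) ℂ),
        (∃ (g h : GL (Fin m) ℂ) (a b : Fin m → ℕ),
          (∀ i, (a i : ℕ∞) ≤ ⊤) ∧ (∀ j, (b j : ℕ∞) ≤ ⊤) ∧ ∑ i, a i = ∑ j, b j ∧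
          (∀ i j, a i < b j →
            ((g : Matrix (Fin m) (Fin m) ℂ).map C * P' * (h : Matrix (Fin m) (Fin m) ℂ).map C :
              Matrix (Fin m) (Fin m) (MvPolynomial (Fin n × Fin n) ℂ)) i j = 0) ∧
          B₁ = Matrix.of fun i j => if a i = b j then
            ((g : Matrix (Fin m) (Fin m) ℂ).map C * P' * (h : Matrix (Fin m) (Fin m) ℂ).map C :
              Matrix (Fin m) (Fin m) (MvPolynomial (Fin n × Fin n) ℂ)) i j else 0) →
        (∃ (g h : GL (Fin m) ℂ) (a b : Fin m → ℕ),
          (∀ i, (a i : ℕ∞) ≤ 0) ∧ (∀ j, (b j : ℕ∞) ≤ 0) ∧ ∑ i, a i = ∑ j, b j ∧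
          (∀ i j, a i < b j →
            ((g : Matrix (Fin m) (Fin m) ℂ).map C * P' * (h : Matrix (Fin m) (Fin m) ℂ).map C :
              Matrix (Fin m) (Fin m) (MvPolynomial (Fin n × Fin n) ℂ)) i j = 0) ∧
          B₁ = Matrix.of fun i j => if a i = b j then
            ((g : Matrix (Fin m) (Fin m) ℂ).map C * P' * (h : Matrix (Fin m) (Fin m) ℂ).map C :
              Matrix (Fin m) (Fin m) (MvPolynomial (Fin n × Fin n) ℂ)) i j else 0)) →
      ∃ (g h : GL (Fin m) ℂ) (a b : Fin m → ℕ),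
        (∀ i, (a i : ℕ∞) ≤ 0) ∧ (∀ j, (b j : ℕ∞) ≤ 0) ∧ ∑ i, a i = ∑ j, b j ∧
        (∀ i j, a i < b j →
          ((g : Matrix (Fin m) (Fin m) ℂ).map C * P * (h : Matrix (Fin m) (Fin m) ℂ).map C :
            Matrix (Fin m) (Fin m) (MvPolynomial (Fin n × Fin n) ℂ)) i j = 0) ∧
        P' = Matrix.of fun i j => if a i = b j then
          ((g : Matrix (Fin m) (Fin m) ℂ).map C * P * (h : Matrix (Fin m) (Fin m) ℂ).map C :
            Matrix (Fin m) (Fin m) (MvPolynomial (Fin n × Fin n) ℂ)) i j else 0 := by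
  intro n m A A' B P P' _hdet hAB hA'B hAP hPc hA'P' hP'c
  -- confluence on `A`: a common degeneration `E₁` of `B` and `P`; `P` closed ⇒ `E₁ = g P h`
  obtain ⟨g₁, h₁, a₁, b₁, -, -, hs₁, hz₁, hB⟩ := hAB
  obtain ⟨g₂, h₂, a₂, b₂, -, -, hs₂, hz₂, hP⟩ := hAP
  obtain ⟨E₁, hBE₁, hPE₁⟩ :=
    exists_common_degeneration A B P g₁ h₁ a₁ b₁ hs₁ hz₁ hB g₂ h₂ a₂ b₂ hs₂ hz₂ hP
  obtain ⟨u₁, v₁, hE₁⟩ := gauge_of_degZero P E₁ (hPc E₁ hPE₁)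
  -- confluence on `A'`: a common degeneration `E₂` of `B` and `P'`; `P'` closed ⇒ `E₂ = g P' h`
  obtain ⟨g₃, h₃, a₃, b₃, -, -, hs₃, hz₃, hB'⟩ := hA'B
  obtain ⟨g₄, h₄, a₄, b₄, -, -, hs₄, hz₄, hP'⟩ := hA'P'
  obtain ⟨E₂, hBE₂, hP'E₂⟩ :=
    exists_common_degeneration A' B P' g₃ h₃ a₃ b₃ hs₃ hz₃ hB' g₄ h₄ a₄ b₄ hs₄ hz₄ hP'
  obtain ⟨u₂, v₂, hE₂⟩ := gauge_of_degZero P' E₂ (hP'c E₂ hP'E₂)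
  -- `E₁`, `E₂` are degeneration-closed (gauge forms of closed matrices)
  have hE₁c := closed_of_gauge P E₁ u₁ v₁ hE₁ hPc
  have hE₂c := closed_of_gauge P' E₂ u₂ v₂ hE₂ hP'c
  -- confluence on `B`: a common degeneration `E₃` of `E₁` and `E₂`, a gauge form of both
  obtain ⟨g₅, h₅, a₅, b₅, -, -, hs₅, hz₅, hE₁'⟩ := hBE₁
  obtain ⟨g₆, h₆, a₆, b₆, -, -, hs₆, hz₆, hE₂'⟩ := hBE₂
  obtain ⟨E₃, h₁₃, h₂₃⟩ :=
    exists_common_degeneration B E₁ E₂ g₅ h₅ a₅ b₅ hs₅ hz₅ hE₁' g₆ h₆ a₆ b₆ hs₆ hz₆ hE₂'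
  obtain ⟨u₃, v₃, hE₃⟩ := gauge_of_degZero E₁ E₃ (hE₁c E₃ h₁₃)
  obtain ⟨u₄, v₄, hE₃'⟩ := gauge_of_degZero E₂ E₃ (hE₂c E₃ h₂₃)
  -- `P ∼ E₁ ∼ E₃ ∼ E₂ ∼ P'`
  have hPE₃ : E₃ = ((u₃ * u₁ : GL (Fin m) ℂ) : Matrix (Fin m) (Fin m) ℂ).map C * P *
      ((v₁ * v₃ : GL (Fin m) ℂ) : Matrix (Fin m) (Fin m) ℂ).map C :=
    gauge_trans P E₁ E₃ u₁ v₁ u₃ v₃ hE₁ hE₃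
  have hE₂P : P' = ((u₂⁻¹ : GL (Fin m) ℂ) : Matrix (Fin m) (Fin m) ℂ).map C * E₂ *
      ((v₂⁻¹ : GL (Fin m) ℂ) : Matrix (Fin m) (Fin m) ℂ).map C := gauge_symm P' E₂ u₂ v₂ hE₂
  have hE₃E₂ : E₂ = ((u₄⁻¹ : GL (Fin m) ℂ) : Matrix (Fin m) (Fin m) ℂ).map C * E₃ *
      ((v₄⁻¹ : GL (Fin m) ℂ) : Matrix (Fin m) (Fin m) ℂ).map C := gauge_symm E₂ E₃ u₄ v₄ hE₃'
  exact degZero_of_gauge P P' _ _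
    (gauge_trans P E₃ P' _ _ _ _ hPE₃ (gauge_trans E₃ E₂ P' _ _ _ _ hE₃E₂ hE₂P))

end Summit.ValiantsHypothesis.ValiantsHypothesis.Theorems.FreeSubtorusOrbitDimensionBound.JordanHolder
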